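import Summits.HodgeConjecture.HodgeConjecture.Theorems.Ring2AbelianAllAndreTransportLatticeCM
import Literature.AlgebraicGeometry.HodgeTheory.HolomorphicBundleChernCharacterTopDegree
import Mathlib.LinearAlgebra.Dual.Lemmas
import Mathlib.LinearAlgebra.PerfectPairing.Basic
import HarnessLib

/-!
# Ring 2 · sub-cell AbelianAll (ALL ABELIAN VARIETIES), André axis, part XVIII-a — THE LIFT (L) FROM TWO
# "HOM ≡ NUM" STATEMENTS: perfectness of the cup pairing on the algebraic classes of the FIBRE (conjecture
# `D(𝒳_t)`, Lieberman's theorem for an abelian fibre, in print) and, on the TOTAL SPACE, "an algebraic class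
# `j_{t*} b` supported on the fibre and numerically orthogonal to `N^p(𝒳)` is homologically zero"
# (conjecture `D(𝒳)` for fibre-supported cycles) — the exact place where "B is known for abelian varieties"
# stops helping

HONEST FRAMING (page 1, verbatim): **research route, not a corollary; conditional on HC_CM plus one named
minimal statement.** Cell line: research route conditional on HC_CM; not a corollary; Q11.4-sentence-2
already refuted in dim ≥ 3. Nothing in this file proves a case of the Hodge conjecture for an abelian variety.
`HC_CM` = `Theses.RankFourFaces.CMAbelianHodge` is a BINDER wherever it occurs; `HC_AV` =
`Theses.PadicSemiregularLift.HodgeAbelianVarieties`; item `Theses.RankFourFaces.CMToAbelian` (stmt-16267) OPEN and not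
closed here. Seat `pub-hodge-ring2-ab-andre-2`, gen 10; brief (iii) "B for abelian varieties themselves is KNOWN —
Lieberman/Kleiman — so identify precisely why that does not suffice".

## The argument (Abdulali 1994 p. 1122 / Milne 2020 Prop. 1 / André 2026 §4.4.1 "conjecture D for the total space",
## stripped to what the proof uses, on the real carriers)

Fix a compact pencil `f : 𝒳 ⟶ S` of abelian `d`-folds, a point `t`, `j = j_t : 𝒳_t ↪ 𝒳`, and `p + q = d`. Write
`N^p(Y) = algebraicClasses Y p`, `C_t = (j^*)⁻¹ N^p(𝒳_t)`, `R_t = N^p(𝒳) + ker j^*` (part XVII-b).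
* TRANSPOSE (§2): `j_*(j^* a ∪ b) = a ∪ j_* b` (projection formula, tree) and `j_*` is injective on `H^{2d}(𝒳_t)`
  (part XI), so **`j^* a ∪ b = 0 ⟺ a ∪ j_* b = 0`**, and by Poincaré duality on `𝒳` (tree, Hatcher 3.38)
  **`j_* b = 0 ⟺ b ∪ j^* W = 0` for every global `W`** (no named fact; compare part XII-b's LINK for the polarisation form).
* THE LIFT (§3): let `ξ = j^* W ∈ N^p(𝒳_t)` and `V = j^* N^p(𝒳) ⊆ N^p(𝒳_t)`. If `b ∈ N^q(𝒳_t)` kills `V`, then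
  `a ∪ j_* b = 0` for all `a ∈ N^p(𝒳)`, so **(Num)** gives `j_* b = 0`, whence `ξ ∪ b = j^*W ∪ b = 0`. So `ξ` is
  orthogonal to `V^⊥ ∩ N^q(𝒳_t)`, and **(Perf)** — every subspace of `N^p(𝒳_t)` is cut out inside `N^p(𝒳_t)` by
  algebraic classes of complementary degree, i.e. the cup pairing `N^p(𝒳_t) × N^q(𝒳_t) → H^{2d}(𝒳_t) ≅ ℂ` is
  non-degenerate on both sides (§1, finite-dimensional linear algebra) — gives `ξ ∈ V`: `C_t ≤ R_t`, the lift (L)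
  at `t` in the lattice form of part XVII-b.
* (Perf) is `D(𝒳_t)` in bidegree `(p, q)` (for an abelian fibre: Lieberman 1968, print; in the tree the named fact
  `Lieberman1968_lefschetzInvolution_algebraic_abelianVariety` records `B(A)`, not used here); at a fibre satisfying the
  Hodge conjecture it is Hodge theory (part XVIII-b). (Num) is `D(𝒳)` in bidegree `(p, q+1)` RESTRICTED to the classes
  `j_* N^q(𝒳_t)` supported on the fibre — a statement about the TOTAL SPACE, which is not an abelian variety: this is
  the precise sense in which Lieberman's theorem does not suffice (RING2-MAP §AbelianAll gen 10).

## What is proved (theorems only; no definition, no named fact, no sorry)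

§1 `mem_of_forall_orthogonal_of_nondegenerate` (+ `'` for pairings into a line): BI-ORTHOGONALITY inside a
finite-dimensional subspace `A ≤ M` relative to `A' ≤ N` for a pairing non-degenerate on `A × A'` (Mathlib duality).
§2 `fiberGysin_cupProduct_map_fiberι`, `cupProduct_map_fiberι_eq_zero_iff`, `eq_zero_of_forall_cupProduct_eq_zero(')`,
`fiberGysin_eq_zero_iff_forall_cupProduct`. §3 **`comap_le_sup_of_biorthogonal_of_numerical`**,
**`comap_le_sup_of_nondegenerate_of_numerical`** (the lift (L) at `t`, degree `p`), `comap_eq_sup_…` (equality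
`C_t = R_t`). §4 per pencil: `(∀ t, Perf_t ∧ Num_t) ⟹ (L∀)|_f ∧ (1.1)_f`; node level:
**`cmFibreAlgebraicLift_of_nondegenerate_of_numerical`** and the row
**`HC_AV_of_HC_CM_of_nondegenerate_of_numerical`** (`h₂₁`, `HC_CM` binders).

References: Abdulali1994FamiliesAV (p. 1122); Milne2020HodgeClassesAV (Prop. 1 p. 7); Andre2026 (§4.4.1, preprint,
cited through `Abdulali1994/LefschetzStandardATransport`); Kleiman1968AlgebraicCycles (§3 D(X)); Lieberman1968;
FultonYoungTableaux1997 (App. B (6)); HatcherAT2002 (§3.3 Prop. 3.38); Andre1996Motifs (§5.1, Lemme 6.3.1, §6.3).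
-/

noncomputable section

set_option linter.dupNamespace false

namespace Summit.HodgeConjecture.HodgeConjecture.Ring2.AbelianAll

open CategoryTheory AlgebraicGeometry
open Literature.AlgebraicGeometry Literature.AlgebraicGeometry.Motives
open Literature.AlgebraicGeometry.HodgeTheory
open Literature.AlgebraicTopology.SingularHomology (singularCohomology cupProduct cupPairing)
open Literature.AlgebraicGeometry.Abdulali1994 (InvariantCyclesHoldFor)
open Literature.AlgebraicGeometry.Deligne1982 (cmLocus)
open Literature.AlgebraicGeometry.Andre1996 (andre1996_cmAnchoredPencil)
open Summit.HodgeConjecture.HodgeConjecture.Theses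

/-! ## §1 Linear algebra: bi-orthogonality inside a subspace for a pairing non-degenerate on it -/

section LinAlg

variable {K : Type*} [Field K] {M N L : Type*} [AddCommGroup M] [Module K M] [AddCommGroup N] [Module K N]
  [AddCommGroup L] [Module K L]

/-- **Bi-orthogonality for a non-degenerate pairing of finite-dimensional subspaces.** Let `B : M × N → K` be
bilinear and `A ≤ M`, `A' ≤ N` finite-dimensional with `B` non-degenerate on `A × A'` on both sides. Then every
subspace `V ≤ A` is cut out inside `A` by `A'`: if `ξ ∈ A` satisfies `B(ξ, b) = 0` for every `b ∈ A'` orthogonal to `V`,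
then `ξ ∈ V` (`A ≃ (A')^*` by the pairing, and `W^{⊥⊥} = W` for subspaces `W` of a finite-dimensional dual).
[folklore] -/
theorem mem_of_forall_orthogonal_of_nondegenerate (B : M →ₗ[K] N →ₗ[K] K) {A : Submodule K M}
    {A' : Submodule K N} [FiniteDimensional K A] [FiniteDimensional K A']
    (h₁ : ∀ a ∈ A, (∀ b ∈ A', B a b = 0) → a = 0) (h₂ : ∀ b ∈ A', (∀ a ∈ A, B a b = 0) → b = 0)
    {V : Submodule K M} (hV : V ≤ A) {ξ : M} (hξ : ξ ∈ A)
    (h : ∀ b ∈ A', (∀ v ∈ V, B v b = 0) → B ξ b = 0) : ξ ∈ V := by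
  set P : A →ₗ[K] A' →ₗ[K] K := B.domRestrict₁₂ A A' with hP
  have hinj : Function.Injective P := by
    intro a₁ a₂ ha
    rw [← sub_eq_zero]
    have h0 : P (a₁ - a₂) = 0 := by rw [map_sub, ha, sub_self]
    refine Subtype.ext ?_
    rw [Submodule.coe_sub, Submodule.coe_zero]
    refine h₁ _ (A.sub_mem a₁.2 a₂.2) fun b hb ↦ ?_
    have := LinearMap.congr_fun h0 ⟨b, hb⟩
    simpa [hP, LinearMap.domRestrict₁₂_apply] using this
  have hinj' : Function.Injective P.flip := by
    intro b₁ b₂ hb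
    rw [← sub_eq_zero]
    have h0 : P.flip (b₁ - b₂) = 0 := by rw [map_sub, hb, sub_self]
    refine Subtype.ext ?_
    rw [Submodule.coe_sub, Submodule.coe_zero]
    refine h₂ _ (A'.sub_mem b₁.2 b₂.2) fun a ha ↦ ?_
    have := LinearMap.congr_fun h0 ⟨a, ha⟩
    simpa [hP, LinearMap.domRestrict₁₂_apply] using this
  haveI : P.IsPerfPair := LinearMap.IsPerfPair.of_injective hinj hinj'
  set e := P.toPerfPair with he
  set VA : Submodule K A := V.comap A.subtype with hVA
  set W : Submodule K (Module.Dual K A') := VA.map e.toLinearMap with hW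
  have hmem : e ⟨ξ, hξ⟩ ∈ W.dualCoannihilator.dualAnnihilator := by
    rw [Submodule.mem_dualAnnihilator]
    intro b' hb'
    rw [Submodule.mem_dualCoannihilator] at hb'
    have hb'V : ∀ v ∈ V, B v b' = 0 := by
      intro v hv
      have hv' : (⟨v, hV hv⟩ : A) ∈ VA := by simpa [hVA] using hv
      have := hb' (e ⟨v, hV hv⟩) (Submodule.mem_map_of_mem hv')
      simpa [he, hP, LinearMap.domRestrict₁₂_apply] using this
    have := h b' b'.2 hb'V
    simpa [he, hP, LinearMap.domRestrict₁₂_apply] using this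
  rw [Subspace.dualCoannihilator_dualAnnihilator_eq] at hmem
  obtain ⟨v, hv, hve⟩ := Submodule.mem_map.1 hmem
  have hvξ : v = ⟨ξ, hξ⟩ := e.injective hve
  rw [hVA, Submodule.mem_comap] at hv
  rw [hvξ] at hv
  exact hv

/-- The same for a pairing with values in a LINE `L` (`dim_K L = 1`), e.g. the cup product into the top cohomology of
a connected closed manifold. [folklore] -/
theorem mem_of_forall_orthogonal_of_nondegenerate' (B : M →ₗ[K] N →ₗ[K] L) (hL : Module.finrank K L = 1)
    {A : Submodule K M} {A' : Submodule K N} [FiniteDimensional K A] [FiniteDimensional K A']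
    (h₁ : ∀ a ∈ A, (∀ b ∈ A', B a b = 0) → a = 0) (h₂ : ∀ b ∈ A', (∀ a ∈ A, B a b = 0) → b = 0)
    {V : Submodule K M} (hV : V ≤ A) {ξ : M} (hξ : ξ ∈ A)
    (h : ∀ b ∈ A', (∀ v ∈ V, B v b = 0) → B ξ b = 0) : ξ ∈ V := by
  haveI : FiniteDimensional K L := Module.finite_of_finrank_eq_succ hL
  let ℓ : L ≃ₗ[K] K := LinearEquiv.ofFinrankEq L K (by rw [hL, Module.finrank_self])
  have hz : ∀ (m : M) (n : N), B.compr₂ ℓ.toLinearMap m n = 0 ↔ B m n = 0 := fun m n ↦ by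
    rw [LinearMap.compr₂_apply]
    exact ℓ.map_eq_zero_iff
  refine mem_of_forall_orthogonal_of_nondegenerate (B.compr₂ ℓ.toLinearMap)
    (fun a ha hab ↦ h₁ a ha fun b hb ↦ (hz a b).1 (hab b hb))
    (fun b hb hab ↦ h₂ b hb fun a ha ↦ (hz a b).1 (hab a ha)) hV hξ fun b hb hbV ↦ ?_
  exact (hz ξ b).2 (h b hb fun v hv ↦ (hz v b).1 (hbV v hv))

end LinAlg

variable {𝒳 S : SchemeOver ℂ}

/-! ## §2 Transpose identities: `j^* a ∪ b = 0 ⟺ a ∪ j_* b = 0`; `j_* b = 0 ⟺ b ⊥ Im j^*` -/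

/-- **`j_{t*}(j_t^* a ∪ b) = a ∪ j_{t*} b`** (projection formula, the tree's `complexGysin_cup`) for `a ∈ H²ᵖ(𝒳)`,
`b ∈ H^{2q}(𝒳_t)`, `p + q = d`, on a compact pencil of abelian `d`-folds. [cite: FultonYoungTableaux1997, Appendix B §B.1 (6)] -/
theorem fiberGysin_cupProduct_map_fiberι {d : ℕ} {f : 𝒳 ⟶ S} (hf : IsCompactAbelianPencil f d) (t : ComplexPoints S)
    {p q : ℕ} (hpq : p + q = d) (a : complexBetti 𝒳 (2 * p)) (b : complexBetti (fiberOver f t) (2 * q)) :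
    fiberGysin hf t d (cupProduct (show 2 * p + 2 * q = 2 * d by omega) (complexBetti.map (fiberι f t) (2 * p) a) b) =
      cupProduct (show 2 * p + 2 * (q + 1) = 2 * (d + 1) by omega) a (fiberGysin hf t q b) := by
  have h := complexGysin_cup (μ := complexOrientationFamily) hasPoincareDuality_complexOrientationFamily
    (hf.isSmoothProjective_fiberOver t) hf.isSmoothProjective_total (fiberι f t)
    (show 2 * p + 2 * q = 2 * d by omega)
    (show 2 * d + 2 * (d + 1) = 2 * (d + 1) + 2 * d by ring)
    (show 2 * q + 2 * (d + 1) = 2 * (q + 1) + 2 * d by omega)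
    (show 2 * p + 2 * (q + 1) = 2 * (d + 1) by omega) a b
  exact h

/-- **`j_t^* a ∪ b = 0 ⟺ a ∪ j_{t*} b = 0`** (`p + q = d`): the projection formula and injectivity of `j_{t*}` on
`H^{2d}(𝒳_t(ℂ); ℂ)` (part XI). [cite: FultonYoungTableaux1997, Appendix B §B.1 (6)] [cite: HatcherAT2002, §3.3 Prop. 3.38] -/
theorem cupProduct_map_fiberι_eq_zero_iff {d : ℕ} {f : 𝒳 ⟶ S} (hf : IsCompactAbelianPencil f d) (t : ComplexPoints S)
    {p q : ℕ} (hpq : p + q = d) (a : complexBetti 𝒳 (2 * p)) (b : complexBetti (fiberOver f t) (2 * q)) :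
    cupProduct (show 2 * p + 2 * q = 2 * d by omega) (complexBetti.map (fiberι f t) (2 * p) a) b = 0 ↔
      cupProduct (show 2 * p + 2 * (q + 1) = 2 * (d + 1) by omega) a (fiberGysin hf t q b) = 0 := by
  rw [← fiberGysin_cupProduct_map_fiberι hf t hpq a b]
  exact ⟨fun h ↦ by rw [h, map_zero], fun h ↦ fiberGysin_top_injective hf t h⟩

section Poincare

variable {n : ℕ} {X : SchemeOver ℂ}

/-- **Left non-degeneracy of the cup product into the top degree** on a smooth projective `n`-fold: if
`x ∪ y = 0` for all `y` of complementary degree then `x = 0` (Poincaré duality over `ℂ`, Hatcher Prop. 3.38, the tree's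
`isPerfPair_cupPairing_complexPoints`). [cite: HatcherAT2002, §3.3 Prop. 3.38] -/
theorem eq_zero_of_forall_cupProduct_eq_zero (hX : IsSmoothProjective n X) {a b : ℕ} (hab : a + b = 2 * n)
    {x : complexBetti X a} (h : ∀ y : complexBetti X b, cupProduct hab x y = 0) : x = 0 := by
  have hP := isPerfPair_cupPairing_complexPoints complexOrientationFamily hX hab
  refine (LinearMap.IsPerfPair.bijective_left (cupPairing (complexOrientationFamily hX) hab)).1 ?_
  rw [map_zero]
  ext y
  rw [Literature.AlgebraicTopology.SingularHomology.cupPairing_apply, h y, map_zero, LinearMap.zero_apply,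
    LinearMap.zero_apply]

/-- **Right non-degeneracy of the cup product into the top degree.** [cite: HatcherAT2002, §3.3 Prop. 3.38] -/
theorem eq_zero_of_forall_cupProduct_eq_zero' (hX : IsSmoothProjective n X) {a b : ℕ} (hab : a + b = 2 * n)
    {y : complexBetti X b} (h : ∀ x : complexBetti X a, cupProduct hab x y = 0) : y = 0 := by
  have hP := isPerfPair_cupPairing_complexPoints complexOrientationFamily hX hab
  refine (LinearMap.IsPerfPair.bijective_right (cupPairing (complexOrientationFamily hX) hab)).1 ?_
  rw [map_zero]
  ext x
  rw [LinearMap.flip_apply, Literature.AlgebraicTopology.SingularHomology.cupPairing_apply, h x, map_zero,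
    LinearMap.zero_apply, LinearMap.zero_apply]

end Poincare

/-- **`j_{t*} b = 0 ⟺ j_t^* W ∪ b = 0` for every global class `W`** (`b ∈ H^{2q}(𝒳_t)`, `p + q = d`): the Gysin
kernel of the fibre is the orthogonal of the invariant classes `Im j_t^*` under the cup product of the fibre (transpose +
Poincaré duality on `𝒳`). No named fact. [cite: FultonYoungTableaux1997, Appendix B §B.1 (6)] [cite: HatcherAT2002, §3.3 Prop. 3.38] -/
theorem fiberGysin_eq_zero_iff_forall_cupProduct {d : ℕ} {f : 𝒳 ⟶ S} (hf : IsCompactAbelianPencil f d)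
    (t : ComplexPoints S) {p q : ℕ} (hpq : p + q = d) (b : complexBetti (fiberOver f t) (2 * q)) :
    fiberGysin hf t q b = 0 ↔ ∀ W : complexBetti 𝒳 (2 * p),
      cupProduct (show 2 * p + 2 * q = 2 * d by omega) (complexBetti.map (fiberι f t) (2 * p) W) b = 0 := by
  refine ⟨fun h W ↦ ?_, fun h ↦ ?_⟩
  · rw [cupProduct_map_fiberι_eq_zero_iff hf t hpq, h, map_zero]
  · exact eq_zero_of_forall_cupProduct_eq_zero' hf.isSmoothProjective_total
      (show 2 * p + 2 * (q + 1) = 2 * (d + 1) by omega) fun W ↦ (cupProduct_map_fiberι_eq_zero_iff hf t hpq W b).1 (h W)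

/-! ## §3 The lift (L) at `t` from (Perf_t) and (Num_t) -/

/-- **THE LIFT FROM BI-ORTHOGONALITY ON THE FIBRE AND "HOM ≡ NUM" FOR FIBRE-SUPPORTED CLASSES ON THE TOTAL SPACE.**
For a compact pencil of abelian `d`-folds, a point `t` and `p + q = d`: IF (Perf_t) every subspace `V ≤ N^p(𝒳_t)` is cut
out inside `N^p(𝒳_t)` by algebraic classes of degree `2q` (`ξ ∈ N^p(𝒳_t)` with `ξ ∪ b = 0` for all `b ∈ N^q(𝒳_t)`
orthogonal to `V` lies in `V`), AND (Num_t) every `b ∈ N^q(𝒳_t)` with `a ∪ j_{t*} b = 0` for all `a ∈ N^p(𝒳)` has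
`j_{t*} b = 0`, THEN `(j_t^*)⁻¹ N^p(𝒳_t) ≤ N^p(𝒳) + ker j_t^*` — every global class algebraic on `𝒳_t` is algebraic
on `𝒳` up to `ker j_t^*` (the lift (L) at `t`, part XVII-b's lattice form). [cite: Milne2020HodgeClassesAV, Prop. 1 (p. 7)]
[cite: Abdulali1994FamiliesAV, p. 1122] [cite: Kleiman1968AlgebraicCycles, §3 (D(X))] -/
theorem comap_le_sup_of_biorthogonal_of_numerical {d : ℕ} {f : 𝒳 ⟶ S} (hf : IsCompactAbelianPencil f d)
    (t : ComplexPoints S) {p q : ℕ} (hpq : p + q = d)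
    (hPerf : ∀ V : Submodule ℂ (complexBetti (fiberOver f t) (2 * p)), V ≤ algebraicClasses (fiberOver f t) p →
      ∀ ξ ∈ algebraicClasses (fiberOver f t) p,
        (∀ b ∈ algebraicClasses (fiberOver f t) q,
          (∀ v ∈ V, cupProduct (show 2 * p + 2 * q = 2 * d by omega) v b = 0) →
            cupProduct (show 2 * p + 2 * q = 2 * d by omega) ξ b = 0) → ξ ∈ V)
    (hNum : ∀ b ∈ algebraicClasses (fiberOver f t) q,
      (∀ a ∈ algebraicClasses 𝒳 p, cupProduct (show 2 * p + 2 * (q + 1) = 2 * (d + 1) by omega) a (fiberGysin hf t q b) = 0) →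
        fiberGysin hf t q b = 0) :
    (algebraicClasses (fiberOver f t) p).comap (complexBetti.map (fiberι f t) (2 * p)).hom ≤
      algebraicClasses 𝒳 p ⊔ LinearMap.ker (complexBetti.map (fiberι f t) (2 * p)).hom := by
  intro W hW
  have hW' : complexBetti.map (fiberι f t) (2 * p) W ∈ algebraicClasses (fiberOver f t) p := hW
  -- `V = j^* N^p(𝒳) ≤ N^p(𝒳_t)`
  set V : Submodule ℂ (complexBetti (fiberOver f t) (2 * p)) :=
    (algebraicClasses 𝒳 p).map (complexBetti.map (fiberι f t) (2 * p)).hom with hV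
  have hVle : V ≤ algebraicClasses (fiberOver f t) p := by
    rw [hV, Submodule.map_le_iff_le_comap]
    exact le_trans le_sup_left (algebraicClasses_sup_ker_le_comap hf p t)
  have hmem : complexBetti.map (fiberι f t) (2 * p) W ∈ V := by
    refine hPerf V hVle _ hW' fun b hb hbV ↦ ?_
    -- `b` kills `V`, so `a ∪ j_* b = 0` for all algebraic `a`, so `j_* b = 0`
    have hb0 : fiberGysin hf t q b = 0 := by
      refine hNum b hb fun a ha ↦ ?_
      rw [← cupProduct_map_fiberι_eq_zero_iff hf t hpq a b]
      exact hbV _ (Submodule.mem_map_of_mem ha)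
    rw [cupProduct_map_fiberι_eq_zero_iff hf t hpq, hb0, map_zero]
  obtain ⟨η, hη, hηW⟩ := Submodule.mem_map.1 hmem
  rw [show W = η + (W - η) by abel]
  refine Submodule.add_mem_sup hη ?_
  rw [LinearMap.mem_ker, map_sub, sub_eq_zero]
  exact hηW.symm

/-- **THE LIFT FROM TWO NON-DEGENERACIES.** Same conclusion with (Perf_t) replaced by its source: the cup pairing
`N^p(𝒳_t) × N^q(𝒳_t) → H^{2d}(𝒳_t(ℂ); ℂ) ≅ ℂ` is non-degenerate on both sides (homological ≡ numerical equivalence on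
the fibre in bidegree `(p, q)` — for an abelian fibre Lieberman's theorem in print; at a fibre satisfying the Hodge
conjecture, Hodge theory, part XVIII-b). [cite: Milne2020HodgeClassesAV, Prop. 1 (p. 7)] [cite: Lieberman1968, main theorem]
[cite: Kleiman1968AlgebraicCycles, §3 (D(X))] -/
theorem comap_le_sup_of_nondegenerate_of_numerical {d : ℕ} {f : 𝒳 ⟶ S} (hf : IsCompactAbelianPencil f d)
    (t : ComplexPoints S) {p q : ℕ} (hpq : p + q = d)
    (hND₁ : ∀ ξ ∈ algebraicClasses (fiberOver f t) p,
      (∀ b ∈ algebraicClasses (fiberOver f t) q, cupProduct (show 2 * p + 2 * q = 2 * d by omega) ξ b = 0) → ξ = 0)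
    (hND₂ : ∀ b ∈ algebraicClasses (fiberOver f t) q,
      (∀ ξ ∈ algebraicClasses (fiberOver f t) p, cupProduct (show 2 * p + 2 * q = 2 * d by omega) ξ b = 0) → b = 0)
    (hNum : ∀ b ∈ algebraicClasses (fiberOver f t) q,
      (∀ a ∈ algebraicClasses 𝒳 p, cupProduct (show 2 * p + 2 * (q + 1) = 2 * (d + 1) by omega) a (fiberGysin hf t q b) = 0) →
        fiberGysin hf t q b = 0) :
    (algebraicClasses (fiberOver f t) p).comap (complexBetti.map (fiberι f t) (2 * p)).hom ≤
      algebraicClasses 𝒳 p ⊔ LinearMap.ker (complexBetti.map (fiberι f t) (2 * p)).hom := by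
  have hXt := hf.isSmoothProjective_fiberOver t
  haveI := finite_complexBetti hXt (2 * p)
  haveI := finite_complexBetti hXt (2 * q)
  refine comap_le_sup_of_biorthogonal_of_numerical hf t hpq (fun V hV ξ hξ h ↦ ?_) hNum
  have hline : Module.finrank ℂ (complexBetti (fiberOver f t) (2 * d)) = 1 := finrank_complexBetti_two_mul_eq_one hXt
  exact mem_of_forall_orthogonal_of_nondegenerate' (cupProduct (show 2 * p + 2 * q = 2 * d by omega)) hline
    hND₁ hND₂ hV hξ h

/-- **Equality `C_t = R_t`** under (Perf_t) (two non-degeneracies) and (Num_t): the classes of the total space algebraic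
on `𝒳_t` are exactly `N^p(𝒳) + ker j_t^*` (`⊇` is unconditional, part XVII-b). [cite: Milne2020HodgeClassesAV, Prop. 1 (p. 7)] -/
theorem comap_eq_sup_of_nondegenerate_of_numerical {d : ℕ} {f : 𝒳 ⟶ S} (hf : IsCompactAbelianPencil f d)
    (t : ComplexPoints S) {p q : ℕ} (hpq : p + q = d)
    (hND₁ : ∀ ξ ∈ algebraicClasses (fiberOver f t) p,
      (∀ b ∈ algebraicClasses (fiberOver f t) q, cupProduct (show 2 * p + 2 * q = 2 * d by omega) ξ b = 0) → ξ = 0)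
    (hND₂ : ∀ b ∈ algebraicClasses (fiberOver f t) q,
      (∀ ξ ∈ algebraicClasses (fiberOver f t) p, cupProduct (show 2 * p + 2 * q = 2 * d by omega) ξ b = 0) → b = 0)
    (hNum : ∀ b ∈ algebraicClasses (fiberOver f t) q,
      (∀ a ∈ algebraicClasses 𝒳 p, cupProduct (show 2 * p + 2 * (q + 1) = 2 * (d + 1) by omega) a (fiberGysin hf t q b) = 0) →
        fiberGysin hf t q b = 0) :
    (algebraicClasses (fiberOver f t) p).comap (complexBetti.map (fiberι f t) (2 * p)).hom =
      algebraicClasses 𝒳 p ⊔ LinearMap.ker (complexBetti.map (fiberι f t) (2 * p)).hom :=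
  le_antisymm (comap_le_sup_of_nondegenerate_of_numerical hf t hpq hND₁ hND₂ hNum) (algebraicClasses_sup_ker_le_comap hf p t)

/-! ## §4 Consequences: (L∀)|_f and (1.1)_f from the hypotheses at every point; the node (L) and the cell row -/

/-- **(L∀)|_f and Abdulali's (1.1)_f from (Perf) and (Num) at EVERY point** of one compact pencil: then
`C_s = N^p(𝒳) + ker j_s^*` for every `s` and every `p ≤ d`, and — `ker j_s^*` being constant (part XVII-e) —
`s ↦ C_s` is constant: `InvariantCyclesHoldFor f d`. (Degrees `p > d` are vacuous: `H²ᵖ(𝒳_s) = 0`.)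
[cite: Abdulali1994FamiliesAV, (1.1) and p. 1122] [cite: Milne2020HodgeClassesAV, Prop. 1 (p. 7)] -/
theorem invariantCyclesHoldFor_of_nondegenerate_of_numerical {d : ℕ} {f : 𝒳 ⟶ S} (hf : IsCompactAbelianPencil f d)
    (h : ∀ (t : ComplexPoints S) (p q : ℕ) (hpq : p + q = d),
      (∀ ξ ∈ algebraicClasses (fiberOver f t) p,
        (∀ b ∈ algebraicClasses (fiberOver f t) q, cupProduct (show 2 * p + 2 * q = 2 * d by omega) ξ b = 0) → ξ = 0) ∧
      (∀ b ∈ algebraicClasses (fiberOver f t) q,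
        (∀ ξ ∈ algebraicClasses (fiberOver f t) p, cupProduct (show 2 * p + 2 * q = 2 * d by omega) ξ b = 0) → b = 0) ∧
      (∀ b ∈ algebraicClasses (fiberOver f t) q,
        (∀ a ∈ algebraicClasses 𝒳 p,
          cupProduct (show 2 * p + 2 * (q + 1) = 2 * (d + 1) by omega) a (fiberGysin hf t q b) = 0) →
          fiberGysin hf t q b = 0)) :
    InvariantCyclesHoldFor f d := by
  rw [invariantCyclesHoldFor_iff_comap_eq hf]
  intro p s s'
  rcases le_or_gt p d with hp | hp
  · obtain ⟨h₁, h₂, h₃⟩ := h s p (d - p) (by omega)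
    obtain ⟨h₁', h₂', h₃'⟩ := h s' p (d - p) (by omega)
    rw [comap_eq_sup_of_nondegenerate_of_numerical hf s (show p + (d - p) = d by omega) h₁ h₂ h₃,
      comap_eq_sup_of_nondegenerate_of_numerical hf s' (show p + (d - p) = d by omega) h₁' h₂' h₃',
      algebraicClasses_sup_ker_eq hf p s s']
  · haveI := subsingleton_complexBetti (hf.isSmoothProjective_fiberOver s) (show 2 * d < 2 * p by omega)
    haveI := subsingleton_complexBetti (hf.isSmoothProjective_fiberOver s') (show 2 * d < 2 * p by omega)
    ext W
    simp only [Submodule.mem_comap]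
    constructor <;> intro _ <;>
      · rw [Subsingleton.elim ((complexBetti.map (fiberι f _) (2 * p)).hom W) 0]; exact Submodule.zero_mem _

/-- **The node (L) `CMFibreAlgebraicLift` from (Perf) and (Num) at the CM points of every compact pencil of abelian
varieties** (lattice form of (L), part XVII-b `cmFibreAlgebraicLift_iff_comap_le_sup`). [cite: Andre1996Motifs, §5.1 (p. 25) and §6.3 (p. 33)]
[cite: Milne2020HodgeClassesAV, Prop. 1 (p. 7)] -/
theorem cmFibreAlgebraicLift_of_nondegenerate_of_numerical
    (h : ∀ ⦃d : ℕ⦄ ⦃𝒳 S : SchemeOver ℂ⦄ (f : 𝒳 ⟶ S) (hf : IsCompactAbelianPencil f d) (t : ComplexPoints S),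
      t ∈ cmLocus f d → ∀ (p q : ℕ) (hpq : p + q = d),
      (∀ ξ ∈ algebraicClasses (fiberOver f t) p,
        (∀ b ∈ algebraicClasses (fiberOver f t) q, cupProduct (show 2 * p + 2 * q = 2 * d by omega) ξ b = 0) → ξ = 0) ∧
      (∀ b ∈ algebraicClasses (fiberOver f t) q,
        (∀ ξ ∈ algebraicClasses (fiberOver f t) p, cupProduct (show 2 * p + 2 * q = 2 * d by omega) ξ b = 0) → b = 0) ∧
      (∀ b ∈ algebraicClasses (fiberOver f t) q,
        (∀ a ∈ algebraicClasses 𝒳 p,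
          cupProduct (show 2 * p + 2 * (q + 1) = 2 * (d + 1) by omega) a (fiberGysin hf t q b) = 0) →
          fiberGysin hf t q b = 0)) :
    CMFibreAlgebraicLift := by
  rw [cmFibreAlgebraicLift_iff_comap_le_sup]
  intro d 𝒳 S f hf p t ht
  rcases le_or_gt p d with hp | hp
  · obtain ⟨h₁, h₂, h₃⟩ := h f hf t ht p (d - p) (by omega)
    exact comap_le_sup_of_nondegenerate_of_numerical hf t (show p + (d - p) = d by omega) h₁ h₂ h₃
  · haveI := subsingleton_complexBetti (hf.isSmoothProjective_fiberOver t) (show 2 * d < 2 * p by omega)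
    intro W _
    refine Submodule.mem_sup_right ?_
    rw [LinearMap.mem_ker]
    exact Subsingleton.elim _ _

/-- **The cell row through (Perf) and (Num): `h₂₁ → HC_CM → [(Perf) ∧ (Num) at the CM points of compact pencils] → HC_AV`**
(part I's `HC_AV_of_HC_CM_and_cmFibreAlgebraicLift`). `HC_CM`, `h₂₁` (André's Lemme 6.3.1) are BINDERS; part XVIII-b
removes (Perf) under `HC_CM`. research route, not a corollary; conditional on HC_CM plus one named minimal statement.
[cite: Andre1996Motifs, Lemme 6.3.1 (p. 31) and §6.3 (p. 33)] [cite: Milne2020HodgeClassesAV, Prop. 1 (p. 7)] -/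
theorem HC_AV_of_HC_CM_of_nondegenerate_of_numerical (h₂₁ : andre1996_cmAnchoredPencil)
    (hCM : RankFourFaces.CMAbelianHodge)
    (h : ∀ ⦃d : ℕ⦄ ⦃𝒳 S : SchemeOver ℂ⦄ (f : 𝒳 ⟶ S) (hf : IsCompactAbelianPencil f d) (t : ComplexPoints S),
      t ∈ cmLocus f d → ∀ (p q : ℕ) (hpq : p + q = d),
      (∀ ξ ∈ algebraicClasses (fiberOver f t) p,
        (∀ b ∈ algebraicClasses (fiberOver f t) q, cupProduct (show 2 * p + 2 * q = 2 * d by omega) ξ b = 0) → ξ = 0) ∧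
      (∀ b ∈ algebraicClasses (fiberOver f t) q,
        (∀ ξ ∈ algebraicClasses (fiberOver f t) p, cupProduct (show 2 * p + 2 * q = 2 * d by omega) ξ b = 0) → b = 0) ∧
      (∀ b ∈ algebraicClasses (fiberOver f t) q,
        (∀ a ∈ algebraicClasses 𝒳 p,
          cupProduct (show 2 * p + 2 * (q + 1) = 2 * (d + 1) by omega) a (fiberGysin hf t q b) = 0) →
          fiberGysin hf t q b = 0)) :
    PadicSemiregularLift.HodgeAbelianVarieties :=
  HC_AV_of_HC_CM_and_cmFibreAlgebraicLift h₂₁ hCM (cmFibreAlgebraicLift_of_nondegenerate_of_numerical h)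

end Summit.HodgeConjecture.HodgeConjecture.Ring2.AbelianAll

end
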